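import Literature.Topology.FourManifolds.FramedTubularNbhd
import Literature.Topology.FourManifolds.DiffeotopyTransport
import Literature.Topology.FourManifolds.ClosedBall
import Literature.Topology.FourManifolds.BandSum
import HarnessLib

/-!
# Thickening an immersed patch of `𝕊³` (step N2 for regular band sums)

Fact seat `provefact-Literature.Topology.FourManifolds.BandData.isIsotopic_of_band_eq`; this is
the first brick of the proof of the corrected geometric heart
`Literature.Topology.FourManifolds.BandData.exists_ambientIsotopy_of_band_eq_of_isRegular`
(`BandSumIsotopyRegular.lean`, § "Plan of the proof": with a regular band, `band` restricted to a
neighbourhood of the closed collar thickens to an open embedding `Θ : U₁ × (-ε, ε) ↪ 𝕊³` with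
`Θ (x, 0) = band x`, along which planar diffeotopies are transported). Everything here is
proved; no named facts are introduced.

Let `β : ℝ² → 𝕊³` be `C^∞` and an injective immersion on the open collar square
`squareNhd δ₀ = (-δ₀, 1 + δ₀)²` (for band data this is exactly `BandData.IsRegular`,
`BandSumIsotopyRegular.lean`, with `β = band`). We construct, for every `-1/2 < δ₁ < δ₀`, a
**thickening of the patch over `squareNhd δ₁`** (`Literature.Topology.FourManifolds.PatchThickening`):
a smooth embedding `emb : ℝ³ ↪ 𝕊³` with open image and a diffeomorphism `param` of `ℝ²` onto an
open set with `squareNhd δ₁ ⊆ param (ℝ²) ⊆ squareNhd δ₀`, such that `emb (y, 0) = β (param y)` on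
the coordinate plane `ℝ² × {0} ⊆ ℝ³` (`nonempty_patchThickening`). Since the source of `emb` is the
whole model space `ℝ³` of `𝕊³`, compactly supported diffeotopies of `ℝ³` — in particular planar
ones acting on the first two coordinates and cut off in the third — are transported to ambient
isotopies of `𝕊³` by the tree's `Diffeotopy.chartTransport` (`DiffeotopyTransport.lean`) after
`exists_chart_of_isSmoothEmbedding` (`ChartTransport.lean`).

## Construction (Hirsch, *Differential Topology* (1976), Ch. 4 §5, Thms. 5.1–5.2)

1. *Squeeze* (`coordBox`, `planeSqueeze`): Mathlib's `univBall` in each coordinate identifies `ℝ²`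
   with `squareNhd δ₀` (smooth, smooth inverse on the square, invertible derivative), so
   `squeezedPatch β δ₀ = β ∘ planeSqueeze δ₀` is a smooth injective immersion of the *whole* plane.
2. *Normal field* (`patchNormal`): at `p = β x` the coefficient vectors of `∂₀β`, `∂₁β` in the
   quaternion frame `p·i, p·j, p·k` of `T_p 𝕊³` (`KnotFraming.lean`) have a cross product; lifted
   back it is a smooth field orthogonal to `β`, `∂₀β`, `∂₁β`, nonzero where `β` is an immersion
   (`patchNormal_ne_zero`, via Mathlib's `crossProduct_ne_zero_iff_linearIndependent`). Hence
   `isNormalFraming_squeezed`: the squeezed patch is normally framed in the sense of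
   `FramedTubularNbhd.lean` (one normal field, `dim ℝ² + 1 = 3`).
3. *Tube* (`exists_uniform_tube`): the radial tube map `(x, u) ↦ (β x + u n x)/‖⋯‖` of
   `FramedTubularNbhd.lean` is a local diffeomorphism along the zero section
   (`IsNormalFraming.isLocalDiffeomorphAt_core_zero`); over a closed disc `B̄(0, R)` of the plane
   it is therefore a local diffeomorphism and injective on a uniform tube `B̄(0, R) × B(0, ε)`
   (`generalized_tube_lemma` and `exists_injOn_prod_ball_of_isCompact`, the compact-subset form of
   the point-set lemma of `FramedTubularNbhd.lean`).
4. *Slab chart* (`slabChart`, `slabDiffeomorph`): `ℝ³ ≅ ℝ² × ℝ¹ ≅ B(0, R) × B(0, ε)` by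
   `EuclideanSpace.finAddEquivProd` and `univBall` in both factors; composing gives the embedding
   `emb : ℝ³ ↪ 𝕊³` (`isSmoothEmbedding_of_isLocalDiffeomorph`), with `R` chosen so that `B(0, R)`
   contains the (compact) preimage of the closed square `closedSquare δ₁`.

## References

* M. W. Hirsch, *Differential Topology*, GTM 33, Springer (1976), Ch. 4 §5, Thms. 5.1–5.2
  (tubular neighbourhoods via a field of transverse planes and a retraction). [HirschDT1976]
* J. M. Lee, *Introduction to Smooth Manifolds*, 2nd ed. (2013), Thm. 6.24, Props. 4.8, 5.2.

## Design notes

* The file is band-data free: it only uses `squareNhd` from `BandSum.lean`; the corollary for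
  `BandData.IsRegular` (choose `δ₁ = (δ + δ₀)/2`) is left to the consumer, to keep the imports of
  this infrastructure file small.
* `PatchThickening` is a structure (data `emb`, `param` and their properties) rather than a
  ten-fold existential, since the transport step consumes the two maps separately.
* Local notation `𝔼 n`, `𝕊 n` and the local instance `fact_finrank_euclideanSpace_succ`
  (`ClosedBall.lean`) follow the directory pattern. Nothing here uses `sorry`.
-/

open scoped Manifold ContDiff Topology RealInnerProductSpace Matrix
open Function Set Metric

noncomputable section

namespace Literature.Topology.FourManifolds

/-- Local notation: `𝔼 n` is the model Euclidean space `EuclideanSpace ℝ (Fin n)`. -/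
local notation "𝔼 " n:arg => EuclideanSpace ℝ (Fin n)

/-- Local notation: `𝕊 n` is the unit sphere in `EuclideanSpace ℝ (Fin (n + 1))`. -/
local notation "𝕊 " n:arg => (Metric.sphere (0 : EuclideanSpace ℝ (Fin (n + 1))) 1)

attribute [local instance] fact_finrank_euclideanSpace_succ


/-! ## Coordinate boxes: products of partial homeomorphisms of the line, read in `𝔼 n` -/

section CoordBox

variable {n : ℕ}

/-- The **coordinatewise partial homeomorphism** of `𝔼 n = EuclideanSpace ℝ (Fin n)` defined by
partial homeomorphisms `e i` of `ℝ` in each coordinate (Mathlib's `OpenPartialHomeomorph.pi`,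
conjugated by the identification `EuclideanSpace.equiv` of `𝔼 n` with `Fin n → ℝ`). Used with
Mathlib's `univBall` in each coordinate to squeeze `𝔼 n` diffeomorphically onto an open box.
[folklore] -/
def coordBox (e : Fin n → OpenPartialHomeomorph ℝ ℝ) : OpenPartialHomeomorph (𝔼 n) (𝔼 n) :=
  ((EuclideanSpace.equiv (Fin n) ℝ).toHomeomorph.transOpenPartialHomeomorph
    (OpenPartialHomeomorph.pi e)).transHomeomorph (EuclideanSpace.equiv (Fin n) ℝ).symm.toHomeomorph

/-- Coordinates of `coordBox e x`. [folklore] -/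
@[simp]
theorem coordBox_apply (e : Fin n → OpenPartialHomeomorph ℝ ℝ) (x : 𝔼 n) (i : Fin n) :
    coordBox e x i = e i (x i) := by
  simp [coordBox]

/-- Coordinates of `(coordBox e).symm y`. [folklore] -/
@[simp]
theorem coordBox_symm_apply (e : Fin n → OpenPartialHomeomorph ℝ ℝ) (y : 𝔼 n) (i : Fin n) :
    (coordBox e).symm y i = (e i).symm (y i) := by
  simp [coordBox]

/-- The source of a coordinate box. [folklore] -/
@[simp]
theorem coordBox_source (e : Fin n → OpenPartialHomeomorph ℝ ℝ) :
    (coordBox e).source = {x | ∀ i, x i ∈ (e i).source} := by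
  ext x
  simp [coordBox]

/-- The target of a coordinate box. [folklore] -/
@[simp]
theorem coordBox_target (e : Fin n → OpenPartialHomeomorph ℝ ℝ) :
    (coordBox e).target = {y | ∀ i, y i ∈ (e i).target} := by
  ext y
  simp [coordBox]

/-- The coordinate functions of `𝔼 n` are smooth. [folklore] -/
theorem contDiff_euclidean_apply (i : Fin n) : ContDiff ℝ ∞ fun x : 𝔼 n ↦ x i :=
  contDiff_euclidean.1 contDiff_id i

/-- A coordinate box with everywhere-defined smooth coordinate maps is smooth. [folklore] -/
theorem contDiff_coordBox {e : Fin n → OpenPartialHomeomorph ℝ ℝ} (he : ∀ i, ContDiff ℝ ∞ (e i)) :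
    ContDiff ℝ ∞ (coordBox e) := by
  rw [contDiff_euclidean]
  intro i
  have : (fun x : 𝔼 n ↦ (coordBox e x) i) = fun x ↦ e i (x i) := funext fun x ↦ coordBox_apply e x i
  rw [this]
  exact (he i).comp (contDiff_euclidean_apply i)

/-- The inverse of a coordinate box is smooth on the target when the coordinate inverses are.
[folklore] -/
theorem contDiffOn_coordBox_symm {e : Fin n → OpenPartialHomeomorph ℝ ℝ}
    (he : ∀ i, ContDiffOn ℝ ∞ (e i).symm (e i).target) :
    ContDiffOn ℝ ∞ (coordBox e).symm (coordBox e).target := by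
  have h : ∀ i, ContDiffOn ℝ ∞ (fun y : 𝔼 n ↦ ((coordBox e).symm y) i) (coordBox e).target := by
    intro i
    have : (fun y : 𝔼 n ↦ ((coordBox e).symm y) i) = fun y ↦ (e i).symm (y i) :=
      funext fun y ↦ coordBox_symm_apply e y i
    rw [this, coordBox_target]
    exact (he i).comp (contDiff_euclidean_apply i).contDiffOn fun y hy ↦ hy i
  intro y hy
  rw [contDiffWithinAt_euclidean]
  exact fun i ↦ h i y hy

end CoordBox

/-! ## Squeezing the plane onto an open collar square -/

section Squeeze

/-- The diffeomorphism of the line onto the open interval `(-δ₀, 1 + δ₀)` (Mathlib's `univBall`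
centred at `1/2` with radius `1/2 + δ₀`). [folklore] -/
def lineSqueeze (δ₀ : ℝ) : OpenPartialHomeomorph ℝ ℝ :=
  OpenPartialHomeomorph.univBall (2⁻¹ : ℝ) (2⁻¹ + δ₀)

/-- The **plane squeeze** onto the open collar square `squareNhd δ₀ = (-δ₀, 1 + δ₀)²`:
`lineSqueeze δ₀` in each coordinate. [folklore] -/
def planeSqueeze (δ₀ : ℝ) : OpenPartialHomeomorph (𝔼 2) (𝔼 2) :=
  coordBox fun _ ↦ lineSqueeze δ₀

variable {δ₀ : ℝ}

/-- The target of the line squeeze is the open interval `(-δ₀, 1 + δ₀)`. [folklore] -/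
theorem lineSqueeze_target (hδ₀ : -2⁻¹ < δ₀) : (lineSqueeze δ₀).target = Ioo (-δ₀) (1 + δ₀) := by
  rw [lineSqueeze, OpenPartialHomeomorph.univBall_target _ (by linarith), Real.ball_eq_Ioo]
  congr 1 <;> ring

/-- The line squeeze is defined everywhere. [folklore] -/
@[simp]
theorem lineSqueeze_source : (lineSqueeze δ₀).source = univ :=
  OpenPartialHomeomorph.univBall_source _ _

/-- The plane squeeze is defined everywhere. [folklore] -/
@[simp]
theorem planeSqueeze_source : (planeSqueeze δ₀).source = univ := by
  simp [planeSqueeze]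

/-- The target of the plane squeeze is the open collar square. [folklore] -/
theorem planeSqueeze_target (hδ₀ : -2⁻¹ < δ₀) : (planeSqueeze δ₀).target = squareNhd δ₀ := by
  ext y
  simp [planeSqueeze, lineSqueeze_target hδ₀, squareNhd]

/-- The plane squeeze is smooth. [folklore] -/
theorem contDiff_planeSqueeze : ContDiff ℝ ∞ (planeSqueeze δ₀) :=
  contDiff_coordBox fun _ ↦ OpenPartialHomeomorph.contDiff_univBall

/-- The inverse of the plane squeeze is smooth on the open collar square. [folklore] -/
theorem contDiffOn_planeSqueeze_symm (hδ₀ : -2⁻¹ < δ₀) :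
    ContDiffOn ℝ ∞ (planeSqueeze δ₀).symm (squareNhd δ₀) := by
  rw [← planeSqueeze_target hδ₀]
  refine contDiffOn_coordBox_symm fun _ ↦ ?_
  rw [lineSqueeze, OpenPartialHomeomorph.univBall_target _ (by linarith)]
  exact OpenPartialHomeomorph.contDiffOn_univBall_symm

/-- The plane squeeze takes values in the open collar square. [folklore] -/
theorem planeSqueeze_mem (hδ₀ : -2⁻¹ < δ₀) (x : 𝔼 2) : planeSqueeze δ₀ x ∈ squareNhd δ₀ := by
  rw [← planeSqueeze_target hδ₀]
  exact (planeSqueeze δ₀).map_source (by simp)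

/-- The plane squeeze is injective. [folklore] -/
theorem planeSqueeze_injective : Injective (planeSqueeze δ₀) := by
  have := (planeSqueeze δ₀).injOn
  rw [planeSqueeze_source] at this
  exact injOn_univ.1 this

/-- The plane squeeze is onto the open collar square. [folklore] -/
theorem planeSqueeze_surjOn (hδ₀ : -2⁻¹ < δ₀) : SurjOn (planeSqueeze δ₀) univ (squareNhd δ₀) := by
  rw [← planeSqueeze_target hδ₀, ← planeSqueeze_source (δ₀ := δ₀)]
  exact (planeSqueeze δ₀).surjOn

/-- `planeSqueeze ∘ planeSqueeze.symm = id` on the open collar square. [folklore] -/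
theorem planeSqueeze_symm_apply (hδ₀ : -2⁻¹ < δ₀) {y : 𝔼 2} (hy : y ∈ squareNhd δ₀) :
    planeSqueeze δ₀ ((planeSqueeze δ₀).symm y) = y :=
  (planeSqueeze δ₀).right_inv (by rwa [planeSqueeze_target hδ₀])

/-- `planeSqueeze.symm ∘ planeSqueeze = id`. [folklore] -/
@[simp]
theorem planeSqueeze_apply_symm (x : 𝔼 2) : (planeSqueeze δ₀).symm (planeSqueeze δ₀ x) = x :=
  (planeSqueeze δ₀).left_inv (by simp)

/-- **The plane squeeze has invertible derivative everywhere** (it is a diffeomorphism onto the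
open square, `OpenPartialHomeomorph.exists_hasFDerivAt_equiv`). [folklore] -/
theorem exists_hasFDerivAt_planeSqueeze (hδ₀ : -2⁻¹ < δ₀) (x : 𝔼 2) :
    ∃ L : (𝔼 2) ≃L[ℝ] 𝔼 2, HasFDerivAt (planeSqueeze δ₀) (L : (𝔼 2) →L[ℝ] 𝔼 2) x := by
  refine OpenPartialHomeomorph.exists_hasFDerivAt_equiv (planeSqueeze δ₀) (by simp)
    (contDiff_planeSqueeze.differentiable (by simp) x) ?_
  exact ((contDiffOn_planeSqueeze_symm hδ₀).differentiableOn (by simp) _ (planeSqueeze_mem hδ₀ x)).differentiableAt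
    ((isOpen_squareNhd δ₀).mem_nhds (planeSqueeze_mem hδ₀ x))

/-- The derivative of the plane squeeze is injective everywhere. [folklore] -/
theorem injective_fderiv_planeSqueeze (hδ₀ : -2⁻¹ < δ₀) (x : 𝔼 2) :
    Injective (fderiv ℝ (planeSqueeze δ₀) x) := by
  obtain ⟨L, hL⟩ := exists_hasFDerivAt_planeSqueeze hδ₀ x
  rw [hL.fderiv]
  exact L.injective

end Squeeze

/-! ## The normal line field of an immersed patch in `𝕊³` -/

section Normal

variable (β : 𝔼 2 → 𝕊 3)

/-- The **partial derivatives** `∂ᵢβ (x) ∈ ℝ⁴` of a patch `β : ℝ² → 𝕊³ ⊆ ℝ⁴` (`i = 0, 1`): the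
Fréchet derivative of `ι ∘ β` at `x` on the coordinate vector `eᵢ`. [folklore] -/
def patchPartial (i : Fin 2) (x : 𝔼 2) : 𝔼 4 :=
  fderiv ℝ (fun y ↦ ((β y : 𝕊 3) : 𝔼 4)) x (EuclideanSpace.single i 1)

/-- The **normal field** of a patch `β : ℝ² → 𝕊³`: at `x`, the tangent vector to `𝕊³` at `β x` with
coefficient vector (in the quaternion frame `p·i, p·j, p·k` of `T_p 𝕊³`, `KnotFraming.lean`) the
cross product of the coefficient vectors of `∂₀β (x)` and `∂₁β (x)`. It is orthogonal to `β x`,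
`∂₀β x`, `∂₁β x`, and nonzero exactly where `β` is an immersion, so it trivialises the normal line
bundle of the immersed patch in `𝕊³` (Hirsch (1976), Ch. 4 §5: a field of transverse lines).
[folklore] -/
def patchNormal (x : 𝔼 2) : 𝔼 4 :=
  frameLift ((β x : 𝕊 3) : 𝔼 4)
    (frameCoord ((β x : 𝕊 3) : 𝔼 4) (patchPartial β 0 x) ⨯₃ frameCoord ((β x : 𝕊 3) : 𝔼 4) (patchPartial β 1 x))

variable {β}

/-- A smooth patch read in `ℝ⁴` is smooth. [folklore] -/
theorem contDiff_coe_patch (hβ : ContMDiff 𝓘(ℝ, 𝔼 2) (𝓡 3) ∞ β) :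
    ContDiff ℝ ∞ fun y ↦ ((β y : 𝕊 3) : 𝔼 4) := by
  rw [← contMDiff_iff_contDiff]
  exact (contMDiff_coe_sphere (E := 𝔼 4) (n := 3)).comp hβ

/-- The partial derivatives of a smooth patch are smooth. [folklore] -/
theorem contDiff_patchPartial (hβ : ContMDiff 𝓘(ℝ, 𝔼 2) (𝓡 3) ∞ β) (i : Fin 2) :
    ContDiff ℝ ∞ (patchPartial β i) :=
  ((contDiff_coe_patch hβ).fderiv_right (m := ∞) (by simp)).clm_apply contDiff_const

/-- Lifting a smooth coefficient field along a smooth base map gives a smooth vector field (the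
version of `ContDiff.frameLift` of `KnotFraming.lean` for an arbitrary normed parameter space).
[folklore] -/
theorem contDiff_frameLift_comp {X : Type*} [NormedAddCommGroup X] [NormedSpace ℝ X] {k : X → 𝔼 4}
    (hk : ContDiff ℝ ∞ k) {v : X → (Fin 3 → ℝ)} (hv : ContDiff ℝ ∞ v) :
    ContDiff ℝ ∞ fun t ↦ frameLift (k t) (v t) := by
  unfold frameLift
  refine ContDiff.sum fun m _ ↦ ?_
  exact ((contDiff_apply ℝ ℝ m).comp hv).smul ((contDiff_quatFrame m).comp hk)

/-- The coefficient vector of a smooth vector field along a smooth base map is smooth (the version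
of `ContDiff.frameCoord` of `KnotFraming.lean` for an arbitrary normed parameter space).
[folklore] -/
theorem contDiff_frameCoord_comp {X : Type*} [NormedAddCommGroup X] [NormedSpace ℝ X] {k : X → 𝔼 4}
    (hk : ContDiff ℝ ∞ k) {x : X → 𝔼 4} (hx : ContDiff ℝ ∞ x) :
    ContDiff ℝ ∞ fun t ↦ frameCoord (k t) (x t) := by
  rw [contDiff_pi]
  intro m
  exact hx.inner ℝ ((contDiff_quatFrame m).comp hk)

/-- The cross product of smooth coefficient fields is smooth. [folklore] -/
theorem contDiff_crossProduct_comp {X : Type*} [NormedAddCommGroup X] [NormedSpace ℝ X]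
    {a b : X → (Fin 3 → ℝ)} (ha : ContDiff ℝ ∞ a) (hb : ContDiff ℝ ∞ b) :
    ContDiff ℝ ∞ fun t ↦ a t ⨯₃ b t := by
  rw [contDiff_pi]
  intro i
  fin_cases i <;>
    simp only [cross_apply] <;>
    exact (((contDiff_apply ℝ ℝ _).comp ha).mul ((contDiff_apply ℝ ℝ _).comp hb)).sub
      (((contDiff_apply ℝ ℝ _).comp ha).mul ((contDiff_apply ℝ ℝ _).comp hb))

/-- **The normal field of a smooth patch is smooth.** [folklore] -/
theorem contDiff_patchNormal (hβ : ContMDiff 𝓘(ℝ, 𝔼 2) (𝓡 3) ∞ β) : ContDiff ℝ ∞ (patchNormal β) := by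
  have hk := contDiff_coe_patch hβ
  exact contDiff_frameLift_comp hk
    (contDiff_crossProduct_comp (contDiff_frameCoord_comp hk (contDiff_patchPartial hβ 0))
      (contDiff_frameCoord_comp hk (contDiff_patchPartial hβ 1)))

/-- The normal field is tangent to the sphere: `⟪n x, β x⟫ = 0`. [folklore] -/
@[simp]
theorem inner_patchNormal_self (x : 𝔼 2) : ⟪patchNormal β x, ((β x : 𝕊 3) : 𝔼 4)⟫ = 0 :=
  inner_frameLift_self _ _

/-- The normal field is orthogonal to `∂₀β`. [folklore] -/
theorem inner_patchNormal_patchPartial_zero (x : 𝔼 2) : ⟪patchNormal β x, patchPartial β 0 x⟫ = 0 := by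
  rw [patchNormal, inner_frameLift_left, dotProduct_comm]
  exact dot_self_cross _ _

/-- The normal field is orthogonal to `∂₁β`. [folklore] -/
theorem inner_patchNormal_patchPartial_one (x : 𝔼 2) : ⟪patchNormal β x, patchPartial β 1 x⟫ = 0 := by
  rw [patchNormal, inner_frameLift_left, dotProduct_comm]
  exact dot_cross_self _ _

/-- Every vector of `ℝ²` is a combination of the two coordinate vectors. [folklore] -/
theorem eq_smul_single_add (u : 𝔼 2) :
    u = u 0 • EuclideanSpace.single (0 : Fin 2) (1 : ℝ) + u 1 • EuclideanSpace.single (1 : Fin 2) (1 : ℝ) := by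
  ext i
  fin_cases i <;> simp

/-- The derivative of the patch applied to any vector is a combination of the partial derivatives,
hence **orthogonal to the normal field**. [folklore] -/
theorem inner_patchNormal_fderiv (x u : 𝔼 2) :
    ⟪patchNormal β x, fderiv ℝ (fun y ↦ ((β y : 𝕊 3) : 𝔼 4)) x u⟫ = 0 := by
  rw [eq_smul_single_add u, map_add, map_smul, map_smul, inner_add_right, inner_smul_right,
    inner_smul_right]
  change u 0 * ⟪patchNormal β x, patchPartial β 0 x⟫ + u 1 * ⟪patchNormal β x, patchPartial β 1 x⟫ = 0
  rw [inner_patchNormal_patchPartial_zero, inner_patchNormal_patchPartial_one, mul_zero, mul_zero,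
    add_zero]

/-- Tangent vectors of a patch are tangent to the sphere: `⟪∂_u β (x), β x⟫ = 0` (differentiate
`‖β‖² = 1`). [folklore] -/
theorem inner_fderiv_coe_patch_self (hβ : ContMDiff 𝓘(ℝ, 𝔼 2) (𝓡 3) ∞ β) (x u : 𝔼 2) :
    ⟪fderiv ℝ (fun y ↦ ((β y : 𝕊 3) : 𝔼 4)) x u, ((β x : 𝕊 3) : 𝔼 4)⟫ = 0 := by
  have hd : HasFDerivAt (fun y ↦ ((β y : 𝕊 3) : 𝔼 4)) (fderiv ℝ (fun y ↦ ((β y : 𝕊 3) : 𝔼 4)) x) x :=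
    ((contDiff_coe_patch hβ).differentiable (by simp) x).hasFDerivAt
  have h := hd.inner ℝ hd
  have hconst : (fun y ↦ ⟪((β y : 𝕊 3) : 𝔼 4), ((β y : 𝕊 3) : 𝔼 4)⟫) = fun _ ↦ (1 : ℝ) := by
    funext y
    rw [real_inner_self_eq_norm_sq, norm_eq_of_mem_sphere, one_pow]
  rw [hconst] at h
  have h0 := congrArg (fun L : (𝔼 2) →L[ℝ] ℝ ↦ L u) ((hasFDerivAt_const (1 : ℝ) x).unique h)
  simp only [zero_apply, ContinuousLinearMap.coe_comp, comp_apply,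
    ContinuousLinearMap.prod_apply, fderivInnerCLM_apply] at h0
  rw [real_inner_comm] at h0
  linarith

/-- **The normal field is nonzero where the patch is an immersion** (its differential read in
`ℝ⁴` is injective): the coefficient vectors of `∂₀β`, `∂₁β` in the quaternion frame are then
linearly independent, so their cross product is nonzero (Mathlib
`crossProduct_ne_zero_iff_linearIndependent`), and `frameLift` is an isometry on coefficient
vectors (`inner_frameLift_frameLift`). [folklore] -/
theorem patchNormal_ne_zero (hβ : ContMDiff 𝓘(ℝ, 𝔼 2) (𝓡 3) ∞ β) {x : 𝔼 2}
    (hx : Injective (fderiv ℝ (fun y ↦ ((β y : 𝕊 3) : 𝔼 4)) x)) : patchNormal β x ≠ 0 := by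
  set p : 𝔼 4 := ((β x : 𝕊 3) : 𝔼 4) with hp
  have hp1 : ‖p‖ = 1 := norm_eq_of_mem_sphere (β x)
  set a : Fin 2 → (Fin 3 → ℝ) := fun i ↦ frameCoord p (patchPartial β i x) with ha
  -- the coefficient vectors are linearly independent
  have hli : LinearIndependent ℝ ![a 0, a 1] := by
    rw [LinearIndependent.pair_iff]
    intro s t hst
    have htan : ∀ i, ⟪patchPartial β i x, p⟫ = 0 := fun i ↦ inner_fderiv_coe_patch_self hβ x _
    have hlift : frameLift p (s • a 0 + t • a 1) = s • patchPartial β 0 x + t • patchPartial β 1 x := by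
      have hlin : frameLift p (s • a 0 + t • a 1) = s • frameLift p (a 0) + t • frameLift p (a 1) := by
        simp only [frameLift, Pi.add_apply, Pi.smul_apply, smul_eq_mul, Finset.smul_sum, smul_smul,
          ← Finset.sum_add_distrib, add_smul, mul_comm s, mul_comm t]
      rw [hlin, ha, frameLift_frameCoord hp1 (htan 0), frameLift_frameCoord hp1 (htan 1)]
    rw [hst] at hlift
    have h0 : s • patchPartial β 0 x + t • patchPartial β 1 x = 0 := by
      rw [← hlift]; simp [frameLift]
    have h0' : fderiv ℝ (fun y ↦ ((β y : 𝕊 3) : 𝔼 4)) x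
        (s • EuclideanSpace.single (0 : Fin 2) (1 : ℝ) + t • EuclideanSpace.single (1 : Fin 2) (1 : ℝ)) = 0 := by
      rw [map_add, map_smul, map_smul]
      exact h0
    have hv := hx (h0'.trans (map_zero _).symm)
    have hs : s = 0 := by simpa using congrArg (fun v : 𝔼 2 ↦ v 0) hv
    have ht : t = 0 := by simpa using congrArg (fun v : 𝔼 2 ↦ v 1) hv
    exact ⟨hs, ht⟩
  have hcross : a 0 ⨯₃ a 1 ≠ 0 := crossProduct_ne_zero_iff_linearIndependent.2 hli
  intro h0
  have := inner_frameLift_frameLift p (a 0 ⨯₃ a 1) (a 0 ⨯₃ a 1)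
  rw [show frameLift p (a 0 ⨯₃ a 1) = patchNormal β x from rfl, h0, inner_zero_left, hp1, one_pow,
    one_mul] at this
  exact hcross (dotProduct_self_eq_zero.1 this.symm)

/-- The differential of a patch read in `ℝ⁴` is injective where the patch is an immersion into
`𝕊³` (the inclusion `𝕊³ ⊆ ℝ⁴` has injective differential, `mfderiv_coe_sphere_injective`).
[folklore] -/
theorem injective_fderiv_coe_patch (hβ : ContMDiff 𝓘(ℝ, 𝔼 2) (𝓡 3) ∞ β) {x : 𝔼 2}
    (hx : Injective (mfderiv 𝓘(ℝ, 𝔼 2) (𝓡 3) β x)) :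
    Injective (fderiv ℝ (fun y ↦ ((β y : 𝕊 3) : 𝔼 4)) x) := by
  have hn : (∞ : ℕ∞ω) ≠ 0 := by simp
  have h1 : fderiv ℝ (fun y ↦ ((β y : 𝕊 3) : 𝔼 4)) x =
      mfderiv 𝓘(ℝ, 𝔼 2) 𝓘(ℝ, 𝔼 4) ((Subtype.val : (𝕊 3) → 𝔼 4) ∘ β) x := mfderiv_eq_fderiv.symm
  rw [h1, mfderiv_comp x ((contMDiff_coe_sphere (E := 𝔼 4) (n := 3)).mdifferentiableAt hn)
    (hβ.mdifferentiableAt hn)]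
  exact (mfderiv_coe_sphere_injective (E := 𝔼 4) (n := 3) (β x)).comp hx

end Normal

/-! ## The framed patch over the whole plane and its radial tube map -/

section Framing

variable (β : 𝔼 2 → 𝕊 3) (δ₀ : ℝ)

/-- The patch pulled back to the whole plane by the squeeze `ℝ² ≅ squareNhd δ₀`. [folklore] -/
def squeezedPatch : 𝔼 2 → 𝕊 3 := β ∘ planeSqueeze δ₀

/-- The normal field of the patch, pulled back to the whole plane (a framing by one vector field,
indexed by `Fin 1` as required by `IsNormalFraming`). [folklore] -/
def squeezedNormal : Fin 1 → 𝔼 2 → 𝔼 4 := fun _ ↦ patchNormal β ∘ planeSqueeze δ₀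

variable {β δ₀}

/-- Unfolding of `squeezedPatch`. [folklore] -/
@[simp]
theorem squeezedPatch_apply (x : 𝔼 2) : squeezedPatch β δ₀ x = β (planeSqueeze δ₀ x) := rfl

/-- Unfolding of `squeezedNormal`. [folklore] -/
@[simp]
theorem squeezedNormal_apply (i : Fin 1) (x : 𝔼 2) : squeezedNormal β δ₀ i x = patchNormal β (planeSqueeze δ₀ x) :=
  rfl

/-- The squeezed patch is smooth. [folklore] -/
theorem contMDiff_squeezedPatch (hβ : ContMDiff 𝓘(ℝ, 𝔼 2) (𝓡 3) ∞ β) :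
    ContMDiff 𝓘(ℝ, 𝔼 2) (𝓡 3) ∞ (squeezedPatch β δ₀) :=
  hβ.comp contDiff_planeSqueeze.contMDiff

/-- The squeezed patch is injective when the patch is injective on the open collar square.
[folklore] -/
theorem injective_squeezedPatch (hδ₀ : -2⁻¹ < δ₀) (hinj : InjOn β (squareNhd δ₀)) :
    Injective (squeezedPatch β δ₀) := fun x y h ↦
  planeSqueeze_injective (hinj (planeSqueeze_mem hδ₀ x) (planeSqueeze_mem hδ₀ y) h)

/-- The squeezed patch is an immersion when the patch is an immersion on the open collar square.
[folklore] -/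
theorem injective_mfderiv_squeezedPatch (hβ : ContMDiff 𝓘(ℝ, 𝔼 2) (𝓡 3) ∞ β) (hδ₀ : -2⁻¹ < δ₀)
    (himm : ∀ x ∈ squareNhd δ₀, Injective (mfderiv 𝓘(ℝ, 𝔼 2) (𝓡 3) β x)) (x : 𝔼 2) :
    Injective (mfderiv 𝓘(ℝ, 𝔼 2) (𝓡 3) (squeezedPatch β δ₀) x) := by
  have hn : (∞ : ℕ∞ω) ≠ 0 := by simp
  have hσ : MDifferentiableAt 𝓘(ℝ, 𝔼 2) 𝓘(ℝ, 𝔼 2) (planeSqueeze δ₀) x :=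
    contDiff_planeSqueeze.contMDiff.mdifferentiableAt hn
  rw [squeezedPatch, mfderiv_comp x (hβ.mdifferentiableAt hn) hσ]
  refine (himm _ (planeSqueeze_mem hδ₀ x)).comp ?_
  rw [mfderiv_eq_fderiv]
  exact injective_fderiv_planeSqueeze hδ₀ x

/-- The ambient differential of the squeezed patch takes values orthogonal to the normal field.
[folklore] -/
theorem inner_patchNormal_ambientDeriv (hβ : ContMDiff 𝓘(ℝ, 𝔼 2) (𝓡 3) ∞ β) (x v : 𝔼 2) :
    ⟪patchNormal β (planeSqueeze δ₀ x), ambientDeriv 𝓘(ℝ, 𝔼 2) (squeezedPatch β δ₀) x v⟫ = 0 := by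
  have hg : DifferentiableAt ℝ (fun y ↦ ((β y : 𝕊 3) : 𝔼 4)) (planeSqueeze δ₀ x) :=
    (contDiff_coe_patch hβ).differentiable (by simp) _
  have hf : DifferentiableAt ℝ (planeSqueeze δ₀) x := contDiff_planeSqueeze.differentiable (by simp) x
  have h : ambientDeriv 𝓘(ℝ, 𝔼 2) (squeezedPatch β δ₀) x v =
      fderiv ℝ (fun y ↦ ((β y : 𝕊 3) : 𝔼 4)) (planeSqueeze δ₀ x) (fderiv ℝ (planeSqueeze δ₀) x v) := by
    rw [ambientDeriv_apply, mfderiv_eq_fderiv]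
    change fderiv ℝ ((fun y ↦ ((β y : 𝕊 3) : 𝔼 4)) ∘ planeSqueeze δ₀) x v = _
    rw [fderiv_comp x hg hf]
    rfl
  rw [h]
  exact inner_patchNormal_fderiv _ _

/-- **The squeezed patch is normally framed by its normal field** (`IsNormalFraming`,
`FramedTubularNbhd.lean`) when the patch is a smooth immersion on the open collar square: the
normal field is smooth, tangent to the sphere, and independent of the tangent plane of the patch
(it is orthogonal to it and nonzero). [folklore] -/
theorem isNormalFraming_squeezed (hβ : ContMDiff 𝓘(ℝ, 𝔼 2) (𝓡 3) ∞ β) (hδ₀ : -2⁻¹ < δ₀)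
    (himm : ∀ x ∈ squareNhd δ₀, Injective (mfderiv 𝓘(ℝ, 𝔼 2) (𝓡 3) β x)) :
    IsNormalFraming 𝓘(ℝ, 𝔼 2) (squeezedPatch β δ₀) (squeezedNormal β δ₀) where
  contMDiff _ := ((contDiff_patchNormal hβ).comp contDiff_planeSqueeze).contMDiff
  inner_eq_zero _ x := inner_patchNormal_self _
  eq_zero_of_eq x v a h := by
    rw [Fin.sum_univ_one, squeezedNormal_apply] at h
    have hn : patchNormal β (planeSqueeze δ₀ x) ≠ 0 :=
      patchNormal_ne_zero hβ (injective_fderiv_coe_patch hβ (himm _ (planeSqueeze_mem hδ₀ x)))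
    have h0 := congrArg (fun w ↦ ⟪patchNormal β (planeSqueeze δ₀ x), w⟫) h
    simp only [inner_add_right, inner_smul_right, inner_zero_right, inner_patchNormal_ambientDeriv hβ,
      zero_add, real_inner_self_eq_norm_sq] at h0
    have ha : a 0 = 0 := by
      rcases mul_eq_zero.1 h0 with h1 | h1
      · exact h1
      · exact absurd (pow_eq_zero_iff two_ne_zero |>.1 h1) (norm_ne_zero_iff.2 hn)
    funext i
    fin_cases i
    exact ha

/-- **On the zero section the radial tube map of the framed patch is the patch.** [folklore] -/
theorem core_zero_eq (hfr : IsNormalFraming 𝓘(ℝ, 𝔼 2) (squeezedPatch β δ₀) (squeezedNormal β δ₀)) (x : 𝔼 2) :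
    hfr.core (x, 0) = β (planeSqueeze δ₀ x) :=
  hfr.core_zero x

/-- **The radial tube map of the framed patch is a local diffeomorphism along the zero section**
(`IsNormalFraming.isLocalDiffeomorphAt_core_zero`, with `dim ℝ² + 1 = 3`). [folklore] -/
theorem isLocalDiffeomorphAt_core_zero_patch (hβ : ContMDiff 𝓘(ℝ, 𝔼 2) (𝓡 3) ∞ β) (hδ₀ : -2⁻¹ < δ₀)
    (himm : ∀ x ∈ squareNhd δ₀, Injective (mfderiv 𝓘(ℝ, 𝔼 2) (𝓡 3) β x)) (x : 𝔼 2) :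
    IsLocalDiffeomorphAt (𝓘(ℝ, 𝔼 2).prod (𝓡 1)) (𝓡 3) ∞ (isNormalFraming_squeezed hβ hδ₀ himm).core
      ((x, 0) : (𝔼 2) × 𝔼 1) :=
  (isNormalFraming_squeezed hβ hδ₀ himm).isLocalDiffeomorphAt_core_zero (contMDiff_squeezedPatch hβ)
    (injective_mfderiv_squeezedPatch hβ hδ₀ himm) (by simp) x

end Framing

/-! ## Uniform tubes over compact pieces of the zero section -/

section Uniform

variable {X Y : Type*} [TopologicalSpace X] [TopologicalSpace Y] [T2Space Y] {F : Type*}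
  [SeminormedAddCommGroup F]

/-- **Local injectivity plus injectivity on a compact part of the zero section gives injectivity
on a uniform tube over it** (the version of `exists_injOn_prod_ball`, `FramedTubularNbhd.lean`, for
a compact subset of a non-compact base): `g : X × F → Y` continuous, `C ⊆ X` compact,
`x ↦ g (x, 0)` injective on `C`, and `g` injective near each `(x, 0)`, `x ∈ C`; then `g` is
injective on `C × B(0, ε)` for some `ε > 0`. Hirsch (1976), Ch. 4, proof of Thm. 5.1 with Ch. 2
§1 Exercise 7. [folklore] -/
theorem exists_injOn_prod_ball_of_isCompact {g : X × F → Y} (hg : Continuous g) {C : Set X}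
    (hC : IsCompact C) (h0 : InjOn (fun x ↦ g (x, 0)) C)
    (hloc : ∀ x ∈ C, ∃ U ∈ 𝓝 (x, (0 : F)), InjOn g U) :
    ∃ ε > 0, InjOn g (C ×ˢ ball (0 : F) ε) := by
  let P : F × F → X × X → Prop := fun uv xy ↦
    g (xy.1, uv.1) = g (xy.2, uv.2) → xy.1 = xy.2 ∧ uv.1 = uv.2
  have hP : ∀ xy ∈ C ×ˢ C, ∀ᶠ z : (F × F) × (X × X) in 𝓝 ((0, 0), xy), P z.1 z.2 := by
    rintro ⟨x, y⟩ ⟨hx, hy⟩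
    have hc1 : Continuous fun z : (F × F) × (X × X) ↦ ((z.2.1, z.1.1) : X × F) := by fun_prop
    have hc2 : Continuous fun z : (F × F) × (X × X) ↦ ((z.2.2, z.1.2) : X × F) := by fun_prop
    by_cases hxy : g (x, 0) = g (y, 0)
    · obtain rfl : x = y := h0 hx hy hxy
      obtain ⟨U, hU, hinj⟩ := hloc x hx
      have h1 : ∀ᶠ z : (F × F) × (X × X) in 𝓝 ((0, 0), (x, x)), (z.2.1, z.1.1) ∈ U :=
        hc1.continuousAt.preimage_mem_nhds hU
      have h2 : ∀ᶠ z : (F × F) × (X × X) in 𝓝 ((0, 0), (x, x)), (z.2.2, z.1.2) ∈ U :=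
        hc2.continuousAt.preimage_mem_nhds hU
      filter_upwards [h1, h2] with z hz1 hz2 hz
      have := hinj hz1 hz2 hz
      exact ⟨congrArg Prod.fst this, congrArg Prod.snd this⟩
    · have hopen : IsOpen {p : Y × Y | p.1 ≠ p.2} := isClosed_diagonal.isOpen_compl
      have hc : Continuous fun z : (F × F) × (X × X) ↦ (g (z.2.1, z.1.1), g (z.2.2, z.1.2)) :=
        (hg.comp hc1).prodMk (hg.comp hc2)
      have h3 : ∀ᶠ z : (F × F) × (X × X) in 𝓝 ((0, 0), (x, y)),
          g (z.2.1, z.1.1) ≠ g (z.2.2, z.1.2) := by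
        refine hc.continuousAt.preimage_mem_nhds (hopen.mem_nhds ?_)
        simpa using hxy
      filter_upwards [h3] with z hz hz'
      exact absurd hz' hz
  have key := (hC.prod hC).eventually_forall_of_forall_eventually hP
  obtain ⟨ε, hε, hball⟩ := Metric.eventually_nhds_iff_ball.1 key
  refine ⟨ε, hε, ?_⟩
  rintro ⟨x, u⟩ ⟨hx, hu⟩ ⟨y, v⟩ ⟨hy, hv⟩ hxy
  have huv : ((u, v) : F × F) ∈ ball (0, 0) ε := by
    rw [← ball_prod_same]
    exact ⟨hu, hv⟩
  obtain ⟨h1, h2⟩ := hball _ huv (x, y) ⟨hx, hy⟩ hxy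
  simp only at h1 h2
  rw [h1, h2]

end Uniform

section Tube

variable {β : 𝔼 2 → 𝕊 3} {δ₀ : ℝ}

/-- **A uniform tube over a bounded part of the plane.** For a patch which is an injective
immersion on the open collar square, pulled back to the plane, and any radius `R`, there is
`ε > 0` such that the radial tube map is injective and a local diffeomorphism on
`B̄(0, R) × B(0, ε) ⊆ ℝ² × ℝ` (compactness of the closed disc; Hirsch (1976), Ch. 4, proof of
Thm. 5.1). [folklore] -/
theorem exists_uniform_tube (hβ : ContMDiff 𝓘(ℝ, 𝔼 2) (𝓡 3) ∞ β) (hδ₀ : -2⁻¹ < δ₀)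
    (hinj : InjOn β (squareNhd δ₀)) (himm : ∀ x ∈ squareNhd δ₀, Injective (mfderiv 𝓘(ℝ, 𝔼 2) (𝓡 3) β x))
    (R : ℝ) :
    ∃ ε > 0, InjOn (isNormalFraming_squeezed hβ hδ₀ himm).core (closedBall (0 : 𝔼 2) R ×ˢ ball (0 : 𝔼 1) ε) ∧
      ∀ q ∈ closedBall (0 : 𝔼 2) R ×ˢ ball (0 : 𝔼 1) ε,
        IsLocalDiffeomorphAt (𝓘(ℝ, 𝔼 2).prod (𝓡 1)) (𝓡 3) ∞ (isNormalFraming_squeezed hβ hδ₀ himm).core q := by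
  set h := isNormalFraming_squeezed hβ hδ₀ himm with hh
  have hloc := isLocalDiffeomorphAt_core_zero_patch hβ hδ₀ himm
  -- local diffeomorphism on a uniform tube
  have hG : IsOpen {q : (𝔼 2) × 𝔼 1 | IsLocalDiffeomorphAt (𝓘(ℝ, 𝔼 2).prod (𝓡 1)) (𝓡 3) ∞ h.core q} :=
    isOpen_setOf_isLocalDiffeomorphAt _
  have hsub : closedBall (0 : 𝔼 2) R ×ˢ ({0} : Set (𝔼 1)) ⊆
      {q : (𝔼 2) × 𝔼 1 | IsLocalDiffeomorphAt (𝓘(ℝ, 𝔼 2).prod (𝓡 1)) (𝓡 3) ∞ h.core q} := by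
    rintro ⟨x, u⟩ ⟨-, hu⟩
    rw [mem_singleton_iff] at hu
    subst hu
    exact hloc x
  obtain ⟨u, v, -, hv, hCu, h0v, huv⟩ :=
    generalized_tube_lemma (isCompact_closedBall (0 : 𝔼 2) R) isCompact_singleton hG hsub
  obtain ⟨ε₁, hε₁, hball₁⟩ := Metric.isOpen_iff.1 hv 0 (h0v rfl)
  -- injectivity on a uniform tube
  obtain ⟨ε₂, hε₂, hinj₂⟩ := exists_injOn_prod_ball_of_isCompact (h.continuous_core (contMDiff_squeezedPatch hβ))
    (isCompact_closedBall (0 : 𝔼 2) R) (C := closedBall 0 R) (fun x _ y _ hxy ↦ by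
      simp only [core_zero_eq] at hxy
      exact injective_squeezedPatch hδ₀ hinj hxy) fun x _ ↦ by
      obtain ⟨Φ, hx, heq⟩ := hloc x
      exact ⟨Φ.source, Φ.open_source.mem_nhds hx, fun a ha b hb hab ↦
        Φ.injOn ha hb (by rwa [← heq ha, ← heq hb])⟩
  refine ⟨min ε₁ ε₂, lt_min hε₁ hε₂, ?_, ?_⟩
  · exact hinj₂.mono (prod_mono le_rfl (ball_subset_ball (min_le_right _ _)))
  · rintro ⟨x, w⟩ ⟨hx, hw⟩
    exact huv ⟨hCu hx, hball₁ (ball_subset_ball (min_le_left _ _) hw)⟩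

end Tube

/-! ## Closed collar squares -/

section ClosedSquare

/-- The closed collar square `[-δ, 1 + δ]²`. [folklore] -/
def closedSquare (δ : ℝ) : Set (𝔼 2) :=
  {x | ∀ i, x i ∈ Icc (-δ) (1 + δ)}

/-- The open collar square lies in the closed one. [folklore] -/
theorem squareNhd_subset_closedSquare (δ : ℝ) : squareNhd δ ⊆ closedSquare δ :=
  fun _ hx i ↦ Ioo_subset_Icc_self (hx i)

/-- A closed collar square lies in every wider open collar square. [folklore] -/
theorem closedSquare_subset_squareNhd {δ δ' : ℝ} (h : δ < δ') : closedSquare δ ⊆ squareNhd δ' :=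
  fun _ hx i ↦ ⟨by linarith [(hx i).1], by linarith [(hx i).2]⟩

/-- The closed collar square is closed. [folklore] -/
theorem isClosed_closedSquare (δ : ℝ) : IsClosed (closedSquare δ) := by
  have : closedSquare δ = ⋂ i, (fun x : 𝔼 2 ↦ x i) ⁻¹' Icc (-δ) (1 + δ) := by
    ext x; simp [closedSquare]
  rw [this]
  exact isClosed_iInter fun i ↦ isClosed_Icc.preimage (contDiff_euclidean_apply i).continuous

/-- The closed collar square is compact (it is a product of compact intervals, read through the
identification `EuclideanSpace.equiv` of `𝔼 2` with `Fin 2 → ℝ`). [folklore] -/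
theorem isCompact_closedSquare (δ : ℝ) : IsCompact (closedSquare δ) := by
  have : closedSquare δ =
      (EuclideanSpace.equiv (Fin 2) ℝ).toHomeomorph ⁻¹' (Set.pi univ fun _ ↦ Icc (-δ) (1 + δ)) := by
    ext x
    simp only [closedSquare, mem_setOf_eq, mem_preimage, mem_univ_pi]
    rfl
  rw [this]
  exact ((EuclideanSpace.equiv (Fin 2) ℝ).toHomeomorph.isCompact_preimage).2
    (isCompact_univ_pi fun _ ↦ isCompact_Icc)

end ClosedSquare

/-! ## The slab chart `ℝ³ ≅ B(0, R) × B(0, ε) ⊆ ℝ² × ℝ` -/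

section Slab

/-- The linear identification `ℝ³ ≅ ℝ² × ℝ¹` (Mathlib's `EuclideanSpace.finAddEquivProd`): the first
two coordinates and the last one. [folklore] -/
def slabEquiv : (𝔼 3) ≃L[ℝ] (𝔼 2) × 𝔼 1 :=
  EuclideanSpace.finAddEquivProd (𝕜 := ℝ) (n := 2) (m := 1)

/-- The **slab chart**: `ℝ³ ≅ ℝ² × ℝ¹` followed by Mathlib's `univBall` squeezes of the two factors
onto `B(0, R)` and `B(0, ε)`; a partial homeomorphism `ℝ³ → ℝ² × ℝ¹` with source `ℝ³` and target
`B(0, R) × B(0, ε)`. [folklore] -/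
def slabChart (R ε : ℝ) : OpenPartialHomeomorph (𝔼 3) ((𝔼 2) × 𝔼 1) :=
  slabEquiv.toHomeomorph.transOpenPartialHomeomorph
    ((OpenPartialHomeomorph.univBall (0 : 𝔼 2) R).prod (OpenPartialHomeomorph.univBall (0 : 𝔼 1) ε))

variable {R ε : ℝ}

/-- The slab chart as a function. [folklore] -/
theorem slabChart_apply (v : 𝔼 3) :
    slabChart R ε v = (OpenPartialHomeomorph.univBall (0 : 𝔼 2) R (slabEquiv v).1,
      OpenPartialHomeomorph.univBall (0 : 𝔼 1) ε (slabEquiv v).2) := rfl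

/-- The inverse of the slab chart as a function. [folklore] -/
theorem slabChart_symm_apply (q : (𝔼 2) × 𝔼 1) :
    (slabChart R ε).symm q = slabEquiv.symm ((OpenPartialHomeomorph.univBall (0 : 𝔼 2) R).symm q.1,
      (OpenPartialHomeomorph.univBall (0 : 𝔼 1) ε).symm q.2) := rfl

/-- The slab chart is defined everywhere. [folklore] -/
@[simp]
theorem slabChart_source : (slabChart R ε).source = univ := by
  simp [slabChart]

/-- The target of the slab chart is `B(0, R) × B(0, ε)`. [folklore] -/
theorem slabChart_target (hR : 0 < R) (hε : 0 < ε) :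
    (slabChart R ε).target = ball (0 : 𝔼 2) R ×ˢ ball (0 : 𝔼 1) ε := by
  simp [slabChart, OpenPartialHomeomorph.univBall_target _ hR, OpenPartialHomeomorph.univBall_target _ hε]

/-- On the plane `ℝ² × {0}` the slab chart is the squeeze of the plane onto `B(0, R)`:
`slabChart (y, 0) = (univBall 0 R y, 0)`. [folklore] -/
theorem slabChart_symm_inl (y : 𝔼 2) :
    slabChart R ε (slabEquiv.symm (y, 0)) = (OpenPartialHomeomorph.univBall (0 : 𝔼 2) R y, 0) := by
  rw [slabChart_apply, ContinuousLinearEquiv.apply_symm_apply, OpenPartialHomeomorph.univBall_apply_zero]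

/-- The slab chart is smooth (for the product model of `ℝ² × ℝ¹`). [folklore] -/
theorem contMDiff_slabChart : ContMDiff 𝓘(ℝ, 𝔼 3) (𝓘(ℝ, 𝔼 2).prod (𝓡 1)) ∞ (slabChart R ε) := by
  have h1 : ContDiff ℝ ∞ fun v : 𝔼 3 ↦ OpenPartialHomeomorph.univBall (0 : 𝔼 2) R (slabEquiv v).1 :=
    OpenPartialHomeomorph.contDiff_univBall.comp (contDiff_fst.comp slabEquiv.contDiff)
  have h2 : ContDiff ℝ ∞ fun v : 𝔼 3 ↦ OpenPartialHomeomorph.univBall (0 : 𝔼 1) ε (slabEquiv v).2 :=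
    OpenPartialHomeomorph.contDiff_univBall.comp (contDiff_snd.comp slabEquiv.contDiff)
  exact h1.contMDiff.prodMk h2.contMDiff

/-- The inverse of the slab chart is smooth on the target (for the product model of `ℝ² × ℝ¹`).
[folklore] -/
theorem contMDiffOn_slabChart_symm (hR : 0 < R) (hε : 0 < ε) :
    ContMDiffOn (𝓘(ℝ, 𝔼 2).prod (𝓡 1)) 𝓘(ℝ, 𝔼 3) ∞ (slabChart R ε).symm (slabChart R ε).target := by
  rw [slabChart_target hR hε]
  have hg : ContMDiff (𝓘(ℝ, 𝔼 2).prod (𝓡 1)) 𝓘(ℝ, 𝔼 3) ∞ (slabEquiv.symm : (𝔼 2) × 𝔼 1 → 𝔼 3) :=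
    contMDiff_prod_self_of_contDiff slabEquiv.symm.contDiff
  have hf : ContMDiffOn (𝓘(ℝ, 𝔼 2).prod (𝓡 1)) (𝓘(ℝ, 𝔼 2).prod (𝓡 1)) ∞
      (fun q : (𝔼 2) × 𝔼 1 ↦ ((OpenPartialHomeomorph.univBall (0 : 𝔼 2) R).symm q.1,
        (OpenPartialHomeomorph.univBall (0 : 𝔼 1) ε).symm q.2))
      (ball (0 : 𝔼 2) R ×ˢ ball (0 : 𝔼 1) ε) := by
    refine ContMDiffOn.prodMk ?_ ?_
    · exact OpenPartialHomeomorph.contDiffOn_univBall_symm.contMDiffOn.comp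
        contMDiff_fst.contMDiffOn fun q hq ↦ hq.1
    · exact OpenPartialHomeomorph.contDiffOn_univBall_symm.contMDiffOn.comp
        contMDiff_snd.contMDiffOn fun q hq ↦ hq.2
  exact hg.comp_contMDiffOn hf

/-- The slab chart as a partial diffeomorphism `ℝ³ → ℝ² × ℝ¹`. [folklore] -/
def slabDiffeomorph (hR : 0 < R) (hε : 0 < ε) :
    PartialDiffeomorph 𝓘(ℝ, 𝔼 3) (𝓘(ℝ, 𝔼 2).prod (𝓡 1)) (𝔼 3) ((𝔼 2) × 𝔼 1) ∞ where
  toPartialEquiv := (slabChart R ε).toPartialEquiv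
  open_source := (slabChart R ε).open_source
  open_target := (slabChart R ε).open_target
  contMDiffOn_toFun := contMDiff_slabChart.contMDiffOn
  contMDiffOn_invFun := contMDiffOn_slabChart_symm hR hε

/-- The slab chart is a local diffeomorphism at every point. [folklore] -/
theorem isLocalDiffeomorphAt_slabChart (hR : 0 < R) (hε : 0 < ε) (v : 𝔼 3) :
    IsLocalDiffeomorphAt 𝓘(ℝ, 𝔼 3) (𝓘(ℝ, 𝔼 2).prod (𝓡 1)) ∞ (slabChart R ε) v :=
  PartialDiffeomorph.isLocalDiffeomorphAt _ _ ∞ (slabDiffeomorph hR hε)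
    (show v ∈ (slabChart R ε).source by simp)

/-- The slab chart is injective. [folklore] -/
theorem slabChart_injective : Injective (slabChart R ε) := by
  have := (slabChart R ε).injOn
  rw [slabChart_source] at this
  exact injOn_univ.1 this

/-- The slab chart takes values in `B(0, R) × B(0, ε)`. [folklore] -/
theorem slabChart_mem (hR : 0 < R) (hε : 0 < ε) (v : 𝔼 3) :
    slabChart R ε v ∈ ball (0 : 𝔼 2) R ×ˢ ball (0 : 𝔼 1) ε := by
  rw [← slabChart_target hR hε]
  exact (slabChart R ε).map_source (by simp)

end Slab

/-! ## Thickenings of an immersed patch -/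

section Thickening

variable (β : 𝔼 2 → 𝕊 3) (δ₀ δ₁ : ℝ)

/-- A **thickening of the patch `β` over the collar square `squareNhd δ₁`** inside the larger collar
`squareNhd δ₀`: a smooth embedding `emb : ℝ³ ↪ 𝕊³` with open image (a chart domain of `𝕊³` valued
in the whole model space `ℝ³`, as used by `chartTransport`), together with a smooth injective
immersion `param : ℝ² → ℝ²` with smooth inverse and open image `squareNhd δ₁ ⊆ param (ℝ²) ⊆
squareNhd δ₀`, such that on the coordinate plane `ℝ² × {0} ⊆ ℝ³` the embedding is the patch:
`emb (y, 0) = β (param y)`. So `emb` thickens the embedded surface `β (param (ℝ²))` normally, and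
planar diffeotopies are transported to `𝕊³` through `emb` (Hirsch (1976), Ch. 4 §5, tubular
neighbourhoods; here codimension one with trivial normal bundle). [folklore] -/
structure PatchThickening where
  /-- The thickening, an open smooth embedding `ℝ³ → 𝕊³`. -/
  emb : 𝔼 3 → 𝕊 3
  /-- The parametrisation of the sheet, a diffeomorphism of `ℝ²` onto an open part of the collar. -/
  param : 𝔼 2 → 𝔼 2
  /-- `emb` is a smooth embedding. -/
  isSmoothEmbedding : Manifold.IsSmoothEmbedding 𝓘(ℝ, 𝔼 3) (𝓡 3) ∞ emb
  /-- `emb` has open image. -/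
  isOpen_range : IsOpen (range emb)
  /-- `param` is smooth. -/
  contDiff_param : ContDiff ℝ ∞ param
  /-- `param` is injective. -/
  injective_param : Injective param
  /-- `param` is an immersion. -/
  injective_fderiv_param : ∀ y, Injective (fderiv ℝ param y)
  /-- `param` has open image. -/
  isOpen_range_param : IsOpen (range param)
  /-- The inverse of `param` is smooth on the image. -/
  contDiffOn_invFun_param : ContDiffOn ℝ ∞ (Function.invFun param) (range param)
  /-- The image of `param` contains the collar square of width `δ₁`. -/
  squareNhd_subset : squareNhd δ₁ ⊆ range param
  /-- The image of `param` lies in the collar square of width `δ₀`. -/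
  range_param_subset : range param ⊆ squareNhd δ₀
  /-- On the coordinate plane the thickening is the patch. -/
  emb_inl : ∀ y : 𝔼 2, emb (slabEquiv.symm (y, 0)) = β (param y)

variable {β δ₀ δ₁}

/-- **Existence of thickenings.** A `C^∞` patch `β : ℝ² → 𝕊³` which is an injective immersion on
the open collar square `squareNhd δ₀` admits a thickening over every narrower collar square
`squareNhd δ₁`, `-1/2 < δ₁ < δ₀`. Construction: pull the patch back to the plane by the squeeze
`ℝ² ≅ squareNhd δ₀`, frame it normally by `patchNormal` (`isNormalFraming_squeezed`), take the radial
tube map `(x, u) ↦ (β x + u n x)/‖⋯‖` of `FramedTubularNbhd.lean`, which is a local diffeomorphism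
along the zero section and hence injective and a local diffeomorphism on a uniform tube
`B̄(0, R) × B(0, ε)` over the (bounded) preimage of the closed square `closedSquare δ₁`
(`exists_uniform_tube`), and precompose with the slab chart `ℝ³ ≅ B(0, R) × B(0, ε)`. Hirsch,
*Differential Topology* (1976), Ch. 4 §5, Thms. 5.1–5.2. [cite: HirschDT1976, Ch. 4 §5 Thms. 5.1–5.2] -/
theorem nonempty_patchThickening (hβ : ContMDiff 𝓘(ℝ, 𝔼 2) (𝓡 3) ∞ β) (hδ₁ : -2⁻¹ < δ₁) (hδ : δ₁ < δ₀)
    (hinj : InjOn β (squareNhd δ₀)) (himm : ∀ x ∈ squareNhd δ₀, Injective (mfderiv 𝓘(ℝ, 𝔼 2) (𝓡 3) β x)) :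
    Nonempty (PatchThickening β δ₀ δ₁) := by
  have hδ₀ : -2⁻¹ < δ₀ := hδ₁.trans hδ
  set σ := planeSqueeze δ₀ with hσ
  -- the preimage of the closed square of width `δ₁` is compact, hence inside a ball `B(0, R)`
  have hCsq : closedSquare δ₁ ⊆ squareNhd δ₀ := closedSquare_subset_squareNhd hδ
  have hC : IsCompact (σ.symm '' closedSquare δ₁) :=
    (isCompact_closedSquare δ₁).image_of_continuousOn
      ((contDiffOn_planeSqueeze_symm hδ₀).continuousOn.mono hCsq)
  obtain ⟨R₀, hR₀⟩ := hC.isBounded.subset_ball 0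
  set R := max R₀ 1 with hR
  have hRpos : 0 < R := lt_of_lt_of_le one_pos (le_max_right _ _)
  have hCR : σ.symm '' closedSquare δ₁ ⊆ ball (0 : 𝔼 2) R := hR₀.trans (ball_subset_ball (le_max_left _ _))
  -- the uniform tube
  obtain ⟨ε, hε, hinjOn, hld⟩ := exists_uniform_tube hβ hδ₀ hinj himm R
  set h := isNormalFraming_squeezed hβ hδ₀ himm with hh
  -- the thickening and the parametrisation
  let emb : 𝔼 3 → 𝕊 3 := h.core ∘ slabChart R ε
  let param : 𝔼 2 → 𝔼 2 := fun y ↦ σ (OpenPartialHomeomorph.univBall (0 : 𝔼 2) R y)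
  have hmem : ∀ v : 𝔼 3, slabChart R ε v ∈ closedBall (0 : 𝔼 2) R ×ˢ ball (0 : 𝔼 1) ε := fun v ↦
    ⟨ball_subset_closedBall (slabChart_mem hRpos hε v).1, (slabChart_mem hRpos hε v).2⟩
  have hld' : IsLocalDiffeomorph 𝓘(ℝ, 𝔼 3) (𝓡 3) ∞ emb := fun v ↦
    (isLocalDiffeomorphAt_slabChart hRpos hε v).comp (K := 𝓡 3) (P := 𝕊 3) (hld _ (hmem v))
  have hinj' : Injective emb := fun v w hvw ↦
    slabChart_injective (hinjOn (hmem v) (hmem w) hvw)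
  -- properties of `param`
  have hBall : ∀ y, OpenPartialHomeomorph.univBall (0 : 𝔼 2) R y ∈ ball (0 : 𝔼 2) R := univBall_mem_ball hRpos
  have hparam : ContDiff ℝ ∞ param := contDiff_planeSqueeze.comp OpenPartialHomeomorph.contDiff_univBall
  have hparam_inj : Injective param := fun y y' hyy' ↦
    univBall_injective R (planeSqueeze_injective hyy')
  have hrange : range param = σ '' ball (0 : 𝔼 2) R := by
    ext z
    constructor
    · rintro ⟨y, rfl⟩
      exact ⟨_, hBall y, rfl⟩
    · rintro ⟨x, hx, rfl⟩
      refine ⟨(OpenPartialHomeomorph.univBall (0 : 𝔼 2) R).symm x, ?_⟩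
      change σ (OpenPartialHomeomorph.univBall (0 : 𝔼 2) R ((OpenPartialHomeomorph.univBall (0 : 𝔼 2) R).symm x)) = σ x
      rw [(OpenPartialHomeomorph.univBall (0 : 𝔼 2) R).right_inv
        (by rwa [OpenPartialHomeomorph.univBall_target _ hRpos])]
  refine ⟨{ emb := emb
            param := param
            isSmoothEmbedding := isSmoothEmbedding_of_isLocalDiffeomorph hld' hinj'
              (ContinuousLinearEquiv.refl ℝ (𝔼 3))
            isOpen_range := hld'.isOpen_range
            contDiff_param := hparam
            injective_param := hparam_inj
            injective_fderiv_param := fun y ↦ ?_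
            isOpen_range_param := ?_
            contDiffOn_invFun_param := ?_
            squareNhd_subset := ?_
            range_param_subset := ?_
            emb_inl := fun y ↦ ?_ }⟩
  · -- immersion: chain rule, both factors with injective derivative
    have hu : DifferentiableAt ℝ (OpenPartialHomeomorph.univBall (0 : 𝔼 2) R) y :=
      (OpenPartialHomeomorph.contDiff_univBall (n := ⊤)).differentiable (by simp) y
    have hs : DifferentiableAt ℝ σ (OpenPartialHomeomorph.univBall (0 : 𝔼 2) R y) :=
      contDiff_planeSqueeze.differentiable (by simp) _
    obtain ⟨L, hL⟩ := OpenPartialHomeomorph.exists_hasFDerivAt_equiv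
      (OpenPartialHomeomorph.univBall (0 : 𝔼 2) R) (by rw [OpenPartialHomeomorph.univBall_source]; exact mem_univ y)
      hu (((OpenPartialHomeomorph.contDiffOn_univBall_symm (n := ⊤)).differentiableOn (by simp) _
        (hBall y)).differentiableAt (isOpen_ball.mem_nhds (hBall y)))
    change Injective (fderiv ℝ (σ ∘ OpenPartialHomeomorph.univBall (0 : 𝔼 2) R) y)
    rw [fderiv_comp y hs hu, hL.fderiv]
    exact (injective_fderiv_planeSqueeze hδ₀ _).comp L.injective
  · -- open image
    rw [hrange]
    exact σ.isOpen_image_of_subset_source isOpen_ball (by simp [hσ])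
  · -- smooth inverse on the image
    have hg : ContDiffOn ℝ ∞ (fun z ↦ (OpenPartialHomeomorph.univBall (0 : 𝔼 2) R).symm (σ.symm z)) (range param) := by
      rw [hrange]
      refine OpenPartialHomeomorph.contDiffOn_univBall_symm.comp
        ((contDiffOn_planeSqueeze_symm hδ₀).mono ?_) ?_
      · rintro _ ⟨x, -, rfl⟩
        exact planeSqueeze_mem hδ₀ x
      · rintro _ ⟨x, hx, rfl⟩
        change σ.symm (σ x) ∈ ball (0 : 𝔼 2) R
        rwa [planeSqueeze_apply_symm]
    refine hg.congr ?_
    rintro _ ⟨y, rfl⟩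
    rw [Function.leftInverse_invFun hparam_inj y]
    change y = (OpenPartialHomeomorph.univBall (0 : 𝔼 2) R).symm (σ.symm (σ (OpenPartialHomeomorph.univBall (0 : 𝔼 2) R y)))
    rw [planeSqueeze_apply_symm, (OpenPartialHomeomorph.univBall (0 : 𝔼 2) R).left_inv
      (by rw [OpenPartialHomeomorph.univBall_source]; exact mem_univ y)]
  · -- the collar square of width `δ₁` is covered
    intro z hz
    rw [hrange]
    refine ⟨σ.symm z, hCR ⟨z, squareNhd_subset_closedSquare δ₁ hz, rfl⟩, ?_⟩
    exact planeSqueeze_symm_apply hδ₀ (hCsq (squareNhd_subset_closedSquare δ₁ hz))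
  · -- inside the collar square of width `δ₀`
    rintro _ ⟨y, rfl⟩
    exact planeSqueeze_mem hδ₀ _
  · -- on the coordinate plane the thickening is the patch
    change h.core (slabChart R ε (slabEquiv.symm (y, 0))) = β (σ (OpenPartialHomeomorph.univBall (0 : 𝔼 2) R y))
    rw [slabChart_symm_inl, core_zero_eq]

end Thickening

end Literature.Topology.FourManifolds
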